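import Summits.NavierStokesRegularity.NavierStokesRegularity.Theses.CoriolisHead
import Summits.NavierStokesRegularity.NavierStokesRegularity.Theorems.ExtremalTypeIConstantSpiralScalingLiouvilleProfileForm
import HarnessLib

/-!
# Route `CoriolisHead`, support item `SolitonToProfile` (stmt-NavierStokesRegularity-22678)

The support item: BOUNDED ROTATED-PROFILE LIOUVILLE (the route's `X`: every smooth bounded solution
`(U, P)` of the rotated Leray profile system
`−νΔU + aU + a DU[y] + (BU − DU[By]) + DU[U] + ∇P = 0`, `div U = 0`, `ν, a > 0`, `B` skew, is
constant) implies the crux `SpiralScalingLiouville` (stmt-NavierStokesRegularity-8216) of route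
`ExtremalTypeIConstant`.

## Proof

Pure glue over the tree. `spiralScalingLiouville_of_rotatedProfileLiouville`
(`Theorems/ExtremalTypeIConstantSpiralScalingLiouvilleProfileForm.lean`) already derives the crux
BY NAME from the PROFILE-FORM Liouville statement: every smooth divergence-free `U` with a `C¹`
pressure solving `−ΔU + ½U + ½DU[y + Ay] − ½AU + DU[U] + ∇P = 0` (`A` skew, any rate) with the
Type-I decay `‖U(y)‖ ≤ K/(‖y‖ + 1)` vanishes (that file integrates the spiral-scaling symmetry to the
rotated self-similar ansatz, builds the pressure, and kills rotating constants by the Oseen gauge).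
`X` is stronger than that hypothesis: take `ν = 1`, `a = ½`, `B = −½A` (skew), upgrade the pressure
to `C^∞` through the equation (`contDiff_infty_pressure_of_rotatedProfileSystem`), note that a
decaying profile is bounded (by `max K 0`), conclude `U ≡ b` from `X`, and read `b = 0` off the
decay at the point `y = (K/‖b‖²) b`, where `‖b‖(‖y‖ + 1) = |K| + ‖b‖ > K`.

This closes a SUPPORT item only: `X` itself (the route's cruxes) and the host route's residuals stay
open; Navier–Stokes regularity is not proved by this file.

No new definitions, no named facts.

## References

* B. Pineau, V. Vicol, arXiv:2607.09619 (2026), (1.7)–(1.10), Conjecture 1.1. [PineauVicol2026]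
* T.-P. Tsai, Arch. Rational Mech. Anal. 143 (1998) 29–51, Theorem 1. [Tsai1998]
* G. Koch, N. Nadirashvili, G. Seregin, V. Šverák, Acta Math. 203 (2009) 83–105
  = arXiv:0709.3599, §1. [KochNadirashviliSereginSverak2009]
-/

noncomputable section

-- the summit and its single sub-problem share the name (CONVENTIONS §1), as in every Theorems file
set_option linter.dupNamespace false

namespace Summit.NavierStokesRegularity.NavierStokesRegularity.Theorems

open Set Function
open scoped ContDiff Laplacian RealInnerProductSpace
open Literature.Analysis.FluidPDE
open Summit.NavierStokesRegularity.NavierStokesRegularity.Theses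

/-- **`SolitonToProfile` (stmt-NavierStokesRegularity-22678).** Bounded rotated-profile Liouville
(`X` of route `CoriolisHead`: every smooth bounded solution of the rotated Leray profile system with
`ν, a > 0` and a skew frame rate `B` is constant) implies `ExtremalTypeIConstant.SpiralScalingLiouville`
(stmt-NavierStokesRegularity-8216). Specialise `X` to `ν = 1`, `a = ½`, `B = −½A` and feed it to the
tree's `spiralScalingLiouville_of_rotatedProfileLiouville`; the pressure is upgraded to `C^∞`
through the equation, a decaying profile is bounded, and the constant value `b` vanishes by the decay
`‖b‖ ≤ K/(‖y‖ + 1)` evaluated at `y = (K/‖b‖²) b`.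
[cite: PineauVicol2026, (1.7)–(1.10) and Conjecture 1.1 (arXiv:2607.09619 p. 3)] -/
theorem coriolisHead_solitonToProfile_proof : CoriolisHead.SolitonToProfile := by
  unfold CoriolisHead.SolitonToProfile
  intro hX
  refine spiralScalingLiouville_of_rotatedProfileLiouville ?_
  intro A hA U P hU hP hdiv heq hdec
  -- the pressure is smooth (through the equation)
  have hP' : ContDiff ℝ ∞ P :=
    SpiralScalingLiouville.Birth.contDiff_infty_pressure_of_rotatedProfileSystem hU hP heq
  obtain ⟨K, hK⟩ := hdec
  -- a decaying profile is bounded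
  have hbdd : ∃ M : ℝ, ∀ y, ‖U y‖ ≤ M := by
    refine ⟨max K 0, fun y => (hK y).trans ?_⟩
    have h1 : (1 : ℝ) ≤ ‖y‖ + 1 := by
      have := norm_nonneg y
      linarith
    rcases le_or_gt K 0 with hK0 | hK0
    · exact (div_nonpos_of_nonpos_of_nonneg hK0 (by positivity)).trans (le_max_right _ _)
    · exact (div_le_self hK0.le h1).trans (le_max_left _ _)
  -- the frame rate `B = −½A` is skew
  have hB : ∀ x, inner ℝ ((-(1 / 2 : ℝ) • A) x) x = 0 := fun x => by
    rw [smul_apply, real_inner_smul_left, hA x, mul_zero]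
  -- the profile system with `ν = 1`, `a = ½`, `B = −½A` is the given one
  have heq' : ∀ y, -((1 : ℝ) • Laplacian.laplacian U y) + (1 / 2 : ℝ) • U y
      + (1 / 2 : ℝ) • fderiv ℝ U y y
      + ((-(1 / 2 : ℝ) • A) (U y) - fderiv ℝ U y ((-(1 / 2 : ℝ) • A) y))
      + convect U U y + gradient P y = 0 := by
    intro y
    have key := heq y
    rw [map_add] at key
    rw [one_smul, smul_apply, smul_apply, map_smul]
    linear_combination (norm := module) key
  obtain ⟨b, hb⟩ := hX 1 (1 / 2) one_pos (by norm_num) (-(1 / 2 : ℝ) • A) U P hU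
    (contDiff_infty.1 hP' 2) hB hdiv heq' hbdd
  -- the constant value inherits the decay, hence vanishes
  have hb0 : b = 0 := by
    by_contra hne
    have hpos : 0 < ‖b‖ := norm_pos_iff.2 hne
    have h1 := hK ((K / ‖b‖ ^ 2) • b)
    rw [hb] at h1
    have hny : ‖(K / ‖b‖ ^ 2) • b‖ = |K| / ‖b‖ := by
      rw [norm_smul, Real.norm_eq_abs, abs_div, abs_of_pos (pow_pos hpos 2)]
      field_simp
    rw [hny] at h1
    have hd : 0 < |K| / ‖b‖ + 1 := by positivity
    have h2 : ‖b‖ * (|K| / ‖b‖ + 1) ≤ K := (le_div_iff₀ hd).1 h1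
    have h3 : ‖b‖ * (|K| / ‖b‖ + 1) = |K| + ‖b‖ := by
      field_simp
    rw [h3] at h2
    have h4 : K ≤ |K| := le_abs_self K
    linarith
  funext y
  rw [hb y, hb0, Pi.zero_apply]

end Summit.NavierStokesRegularity.NavierStokesRegularity.Theorems

end
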